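import Summits.Ventures.YMGap.Thresholds.StarMassGapSUN
import Summits.Ventures.YMGap.Thresholds.OneLinkVarianceSD
import HarnessLib

/-!
# Venture YMGap — track (a) for `SU(3)`: `ImprovedThreshold 4 3 (7/200)` HYPOTHESIS-FREE, from the Poincaré × Schwinger–Dyson modulus
# through ds-1's star door

HONEST FRAMING: venture file of the cell `pub-ymgap` (QuantumFields programme), seat engine-2 (g9); 0 compute.  Strong-coupling LATTICE
statements for `SU(3)` lattice Yang–Mills on `ℤ⁴` (Wilson action, tree coupling `3·x`, 't Hooft `x = β_W/9`); nothing about the continuum;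
no decay rate beyond `∃ c > 0`.  OUTPUT (hypothesis-free, kernel-checked), from `OneLinkVarianceSD.oneLinkKRModulus_pv` (Bakry–Émery Poincaré
for the test function × p2's Schwinger–Dyson second moment for the linear observable; `K_PV(3, 21/100) ≤ 50637/20000 = 2.5319`) through
ds-1's star door `StarSUNLimit.star_massGapAt_of_oneLinkKRModulus` (`4·K·|x| ≤ 9/25` on the ball `R = 6|x| ≤ 21/100`):
* `massGapAt_su3_pv`: `MassGapAt 4 3 x` at every 't Hooft `|x| ≤ 7/200` — DLR uniqueness + the Shen–Zhu–Zhu covariance clause for every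
  DLR state of the `ℤ⁴` specification (the cell's Wilson currency);
* `improvedThreshold_su3_pv : ImprovedThreshold 4 3 (7/200)` (`0.035`, Wilson `β_W < 63/200 = 0.315`).
WHAT MOVES: the hypothesis-free `SU(3)` entries of the track-(a) column were `ImprovedThreshold 4 N (9/308)` (every `N ≥ 2`, ds-1's quarter-free
star, `0.0292`), `ImprovedThreshold 4 N (4/125)` (every `N ≥ 3`, p2's variance-refined level-two modulus, `0.032`; the later `K₂Q`/`K₂B` columns
start at `N ≥ 4`); for `N = 3` exactly this file gives `7/200 = 0.035` (`+9 %`; against Shen–Zhu–Zhu's printed `1/48`: `×1.68`; against the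
sharp Bakry–Émery window `1/32`: `+12 %`).  The CERTIFIED `SU(3)` threshold GIVEN H1, H2 (`StarSU3CertifiedThreshold`, radius cap `11/30`) is
untouched.  Sentence-grade; not a headline; the PV modulus is a small-`N` lever and gives nothing new for `N ≥ 4` here (p2's `K₂B` is smaller
at `R ≈ 0.2`).

References: H. Shen, R. Zhu, X. Zhu, CMP 400 (2023) 805–851 (arXiv:2204.12737), Thm. 1.2 / Cor. 1.6 / Rem. 1.3; the tree:
`Thresholds/OneLinkVarianceSD.lean` (engine-2 g9), `Thresholds/StarMassGapSUN.lean` (ds-1), `Thresholds/OneLinkLevelTwoSDRows.lean` (p2).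
-/

noncomputable section

open Literature.MathematicalPhysics.QuantumFieldTheory
open Literature.MathematicalPhysics.QuantumFieldTheory.Balaban1983to89.StrongCouplingDobrushinWindow (OneLinkKRModulus)
open Summit.Ventures.YMGap.StarSUNLimit (star_massGapAt_of_oneLinkKRModulus)
open Summit.Ventures.YMGap.OneLinkVarianceSD (su3_oneLinkKRModulus_pv_of_le)

namespace Summit.Ventures.YMGap.OneLinkVarianceSD

/-- `SU(3)`, radius `21/100` (`= 6 · 7/200`): `OneLinkKRModulus 3 (21/100) (50637/20000)` hypothesis-free (`K_PV(3, 0.21) = 2.5318…`;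
certificate `q = 26211/25000`, `p = 928477/500000`). [folklore] -/
theorem su3_oneLinkKRModulus_pv_twentyOneHundredths : OneLinkKRModulus 3 (21 / 100) (50637 / 20000) :=
  su3_oneLinkKRModulus_pv_of_le (q := 26211 / 25000) (p := 928477 / 500000)
    (by norm_num) (by norm_num) (by norm_num) (by norm_num) (by norm_num) (by norm_num) (by norm_num)

/-- **`MassGapAt 4 3 x` at every 't Hooft `|x| ≤ 7/200`, HYPOTHESIS-FREE** (`SU(3)`, `d = 4`; Wilson `β_W = 9x ≤ 63/200`): ds-1's star door
on the PV modulus at radius `21/100 ≥ 6|x|` (`4 · (50637/20000) · (7/200) = 0.3545 ≤ 9/25`). [cite: arXiv220412737, Thm. 1.2 and Cor. 1.6] -/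
theorem massGapAt_su3_pv {x : ℝ} (h : |x| ≤ 7 / 200) : MassGapAt 4 3 x := by
  have hx0 : 0 ≤ |x| := abs_nonneg x
  refine star_massGapAt_of_oneLinkKRModulus (N := 3) (by norm_num) (K := 50637 / 20000) (R := 21 / 100) (by norm_num)
    (by linarith) su3_oneLinkKRModulus_pv_twentyOneHundredths ?_
  nlinarith

/-- **`ImprovedThreshold 4 3 (7/200)`, HYPOTHESIS-FREE** (`0.035 > 1/48`; Wilson `β_W < 0.315`). [folklore] -/
theorem improvedThreshold_su3_pv : ImprovedThreshold 4 3 (7 / 200) :=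
  ⟨by norm_num, fun _ hx => massGapAt_su3_pv hx.le⟩

end Summit.Ventures.YMGap.OneLinkVarianceSD

end
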